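import Summits.QuantumFields.YangMills.Theorems.FradkinShenkerFlowFiniteSusceptibilityWeakCouplingMirrorLogConvex
import HarnessLib

/-!
# The axial susceptibility of a species on a torus is non-negative (item stmt-QuantumFields-9442)

Support file for item stmt-QuantumFields-9442 (route `FradkinShenkerFlow` of `YangMills`), crux
`Summit.QuantumFields.YangMills.Theses.FradkinShenkerFlow.FiniteSusceptibilityWeakCoupling`, line `purity-rate-split`
(`Cruxes/FiniteSusceptibilityWeakCoupling/Lines/purity_rate_split.lean`), stub `stub_axialSusceptibilityNonneg`
(the sum rule behind "reflection-odd species have no mirror long-range order").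

**Proved, for every compact `G`, every lattice representation `r` and EVERY real `β`.** On the torus of side
`L = 2S+1` with Wilson measure `μ = μ_{β,L}` (a probability measure for every real `β`), the axial autocorrelation
of a gauge-invariant local observable `A`,
`c(n) = Cov_μ(A∘lift, A∘τ_{-n e₀}∘lift) = latticeConnectedCorr r.ρ β L A.F A.F n`
(`SiblingFunnel.covariance_eq_latticeConnectedCorr`), satisfies the sum rule
`L · Σ_{n<L} c(n) = Cov_μ(Y, Y) = Var_μ(Y) ≥ 0`, `Y = Σ_{t<L} A∘τ_{-t e₀}∘lift`.

Mechanism (`AxialSusceptibility.*`): with `X t := A∘τ_{-t e₀}∘lift` (`t : Fin L`) and `Y := Σ_t X t`,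
`0 ≤ Var Y = Cov(Y, Y) = Σ_s Σ_t Cov(X s, X t)` (bilinearity, `covariance_fun_sum_fun_sum`); translation
invariance of `μ` along the time axis and `L`-periodicity of the lift give `Cov(X s, X t) = c(t - s)` with the
lag `t - s` computed in `Fin L = ℤ/L` (`cov_translates`); for fixed `s`, `t ↦ t - s` is a bijection of `Fin L`
(`Equiv.subRight`), so `Σ_t Cov(X s, X t) = Σ_{n<L} c(n)` and `Cov(Y, Y) = L · Σ_{n<L} c(n)`.
No definition is introduced; nothing here is a named fact. [folklore]
-/

noncomputable section

open MeasureTheory ProbabilityTheory Finset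
open Literature.MathematicalPhysics.QuantumFieldTheory hiding Site ZdEdge
open Literature.MathematicalPhysics.QuantumLattice
open Literature.Probability.LatticeModels hiding configShift configShift_apply

namespace Summit.QuantumFields.YangMills.Theorems.FiniteSusceptibilityWeakCoupling

namespace AxialSusceptibility

open MirrorDominationAxis0 MirrorLogConvex

variable {G : Type} [Group G] [TopologicalSpace G] [IsTopologicalGroup G] [CompactSpace G]
  [MeasurableSpace G] [BorelSpace G]

omit [Group G] [TopologicalSpace G] [IsTopologicalGroup G] [CompactSpace G] [BorelSpace G] in
/-- **The lag of two time translates, read on the torus.** For `s t : Fin L`, translating the lifted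
configuration by `-t e₀ + s e₀` is translating it by `-(t - s) e₀` with `t - s` computed in `Fin L = ℤ/L`: without
wrap-around (`s ≤ t`) the two vectors coincide, with wrap-around (`t < s`) they differ by the period `L e₀`
(`configShift_single_period`). [folklore] -/
theorem configShift_lag {L : ℕ} [NeZero L] (s t : Fin L) (U : GaugeConfig 4 L G) :
    configShift (-(Pi.single 0 ((t : ℕ) : ℤ)) + Pi.single 0 ((s : ℕ) : ℤ)) (torusLift L U) =
      configShift (-(Pi.single 0 (((t - s : Fin L) : ℕ) : ℤ))) (torusLift L U) := by
  have hs := s.isLt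
  rcases le_or_gt s t with h | h
  · -- no wrap-around: the lag is `t - s`
    have hle : (s : ℕ) ≤ (t : ℕ) := h
    have hv : (-(Pi.single 0 ((t : ℕ) : ℤ)) + Pi.single 0 ((s : ℕ) : ℤ) : Site 4) =
        -(Pi.single 0 (((t : ℕ) - (s : ℕ) : ℕ) : ℤ)) := by
      funext k
      rcases eq_or_ne k 0 with rfl | hk
      · simp only [Pi.single_eq_same, Pi.add_apply, Pi.neg_apply]; omega
      · simp [hk]
    rw [hv, Fin.coe_sub_iff_le.2 h]
  · -- wrap-around: the lag is `L + t - s`; the two vectors differ by the period `L e₀`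
    have hlt : (t : ℕ) < (s : ℕ) := h
    have hv : (-(Pi.single 0 ((t : ℕ) : ℤ)) + Pi.single 0 ((s : ℕ) : ℤ) : Site 4) =
        Pi.single 0 (((s : ℕ) - (t : ℕ) : ℕ) : ℤ) := by
      funext k
      rcases eq_or_ne k 0 with rfl | hk
      · simp only [Pi.single_eq_same, Pi.add_apply, Pi.neg_apply]; omega
      · simp [hk]
    rw [hv, Fin.coe_sub_iff_lt.2 h,
      configShift_single_period (L := L) (j := (s : ℕ) - (t : ℕ)) (n := L + (t : ℕ) - (s : ℕ)) (by omega)]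

variable (r : LatticeRep G) (β : ℝ) (A : YMSpecies G)

/-- **Covariance of two time translates = the autocorrelation at the periodic lag** (every real `β`): on the torus of
side `2S+1`, `Cov(A∘τ_{-s e₀}∘lift, A∘τ_{-t e₀}∘lift) = c(t - s)`, the lag computed in `Fin (2S+1)` (translation
invariance `cov_translate_left`, periodicity `configShift_lag`, `SiblingFunnel.covariance_eq_latticeConnectedCorr`).
[folklore] -/
theorem cov_translates (S : ℕ) (s t : Fin (2 * S + 1)) :
    cov[fun U => A.F (configShift (-(Pi.single 0 ((s : ℕ) : ℤ))) (torusLift (2 * S + 1) U)),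
        fun U => A.F (configShift (-(Pi.single 0 ((t : ℕ) : ℤ))) (torusLift (2 * S + 1) U));
        wilsonMeasure (d := 4) (L := 2 * S + 1) r.ρ β] =
      latticeConnectedCorr r.ρ β (2 * S + 1) A.F A.F ((t - s : Fin (2 * S + 1)) : ℕ) := by
  rw [cov_translate_left r.ρ β A.F A.F rfl]
  simp only [configShift_lag]
  exact SiblingFunnel.covariance_eq_latticeConnectedCorr r β A A S _

/-- The time translates of a lifted species are square integrable (bounded and measurable under a probability
measure). [folklore] -/
theorem memLp_translate (S : ℕ) (t : Fin (2 * S + 1)) :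
    MemLp (fun U : GaugeConfig 4 (2 * S + 1) G =>
        A.F (configShift (-(Pi.single 0 ((t : ℕ) : ℤ))) (torusLift (2 * S + 1) U))) 2
      (wilsonMeasure (d := 4) (L := 2 * S + 1) r.ρ β) := by
  haveI : IsProbabilityMeasure (wilsonMeasure (d := 4) (L := 2 * S + 1) r.ρ β) :=
    isProbabilityMeasure_wilsonMeasure _ r.continuous β
  obtain ⟨a, ha⟩ := A.bounded
  exact MemLp.of_bound
    (A.measurable.comp ((configShift _).measurable.comp (measurable_torusLift _))).aestronglyMeasurable a
    (ae_of_all _ fun U => by simpa [Real.norm_eq_abs] using ha _)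

/-- **The axial sum rule** (every real `β`): for `Y = Σ_{t : Fin L} A∘τ_{-t e₀}∘lift` on the torus of side `L = 2S+1`,
`Cov(Y, Y) = L · Σ_{n<L} c(n)` — bilinearity of the covariance, `cov_translates`, and the reindexing `t ↦ t - s` of
`Fin L` for each fixed `s`. [folklore] -/
theorem cov_axialSum (S : ℕ) :
    cov[fun U => ∑ t : Fin (2 * S + 1), A.F (configShift (-(Pi.single 0 ((t : ℕ) : ℤ))) (torusLift (2 * S + 1) U)),
        fun U => ∑ t : Fin (2 * S + 1), A.F (configShift (-(Pi.single 0 ((t : ℕ) : ℤ))) (torusLift (2 * S + 1) U));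
        wilsonMeasure (d := 4) (L := 2 * S + 1) r.ρ β] =
      ((2 * S + 1 : ℕ) : ℝ) *
        ∑ n ∈ Finset.range (2 * S + 1), latticeConnectedCorr r.ρ β (2 * S + 1) A.F A.F n := by
  haveI : IsProbabilityMeasure (wilsonMeasure (d := 4) (L := 2 * S + 1) r.ρ β) :=
    isProbabilityMeasure_wilsonMeasure _ r.continuous β
  rw [covariance_fun_sum_fun_sum (memLp_translate r β A S) (memLp_translate r β A S)]
  simp only [cov_translates r β A S]
  have hinner : ∀ s : Fin (2 * S + 1),
      ∑ t : Fin (2 * S + 1), latticeConnectedCorr r.ρ β (2 * S + 1) A.F A.F ((t - s : Fin (2 * S + 1)) : ℕ) =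
        ∑ n ∈ Finset.range (2 * S + 1), latticeConnectedCorr r.ρ β (2 * S + 1) A.F A.F n := fun s => by
    rw [Finset.sum_range]
    exact Equiv.sum_comp (Equiv.subRight s)
      (fun n : Fin (2 * S + 1) => latticeConnectedCorr r.ρ β (2 * S + 1) A.F A.F n)
  simp only [hinner, Finset.sum_const, Finset.card_univ, Fintype.card_fin, nsmul_eq_mul]

/-- **The axial susceptibility is non-negative** (every compact `G`, every `r`, every real `β`):
`0 ≤ Σ_{n<2S+1} latticeConnectedCorr r.ρ β (2S+1) A.F A.F n`, since `(2S+1)` times it is `Cov(Y, Y) = Var Y ≥ 0`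
(`cov_axialSum`, `covariance_self`, `variance_nonneg`). [folklore] -/
theorem axialSusceptibility_nonneg (S : ℕ) :
    0 ≤ ∑ n ∈ Finset.range (2 * S + 1), latticeConnectedCorr r.ρ β (2 * S + 1) A.F A.F n := by
  have hm : Measurable fun U : GaugeConfig 4 (2 * S + 1) G =>
      ∑ t : Fin (2 * S + 1), A.F (configShift (-(Pi.single 0 ((t : ℕ) : ℤ))) (torusLift (2 * S + 1) U)) :=
    Finset.measurable_sum _ fun t _ =>
      A.measurable.comp ((configShift _).measurable.comp (measurable_torusLift _))
  have h0 : 0 ≤ cov[fun U => ∑ t : Fin (2 * S + 1),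
        A.F (configShift (-(Pi.single 0 ((t : ℕ) : ℤ))) (torusLift (2 * S + 1) U)),
      fun U => ∑ t : Fin (2 * S + 1), A.F (configShift (-(Pi.single 0 ((t : ℕ) : ℤ))) (torusLift (2 * S + 1) U));
      wilsonMeasure (d := 4) (L := 2 * S + 1) r.ρ β] := by
    rw [covariance_self hm.aemeasurable]
    exact variance_nonneg _ _
  rw [cov_axialSum r β A S] at h0
  exact (mul_nonneg_iff_of_pos_left (by positivity)).1 h0

end AxialSusceptibility

/-- **Registered sub-goal `stub_axialSusceptibilityNonneg`** of item stmt-QuantumFields-9442 (signature verbatim): the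
axial susceptibility of a species on a torus is non-negative — for every compact `G`, every lattice representation `r`,
EVERY real `β`, every gauge-invariant local observable `A` and every odd torus `L = 2S+1`,
`0 ≤ Σ_{n<L} latticeConnectedCorr r.ρ β L A.F A.F n`, because `L` times this sum is the variance of the axial sum
`Σ_{t<L} A∘τ_{-t e₀}∘lift` under the (translation-invariant, probability) Wilson measure
(`AxialSusceptibility.cov_axialSum`, `AxialSusceptibility.axialSusceptibility_nonneg`). [folklore] -/
theorem stub_axialSusceptibilityNonneg : ∀ (G : Type) [Group G] [TopologicalSpace G] [IsTopologicalGroup G] [CompactSpace G] [MeasurableSpace G] [BorelSpace G] (r : Literature.MathematicalPhysics.QuantumFieldTheory.LatticeRep G) (β : ℝ) (A : Literature.MathematicalPhysics.QuantumFieldTheory.YMSpecies G) (S : ℕ), 0 ≤ ∑ n ∈ Finset.range (2 * S + 1), Literature.MathematicalPhysics.QuantumFieldTheory.latticeConnectedCorr r.ρ β (2 * S + 1) A.F A.F n :=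
  fun _G _ _ _ _ _ _ r β A S => AxialSusceptibility.axialSusceptibility_nonneg r β A S

end Summit.QuantumFields.YangMills.Theorems.FiniteSusceptibilityWeakCoupling
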